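/-
Origin: expansion seat `prover-pub-hodgecm-own-mu-0`, handover #MU1 2026-08-21T04:34:36Z md5 ee2601ba33d7 (166 l.; NEW; imports HodgeCM.Model.ArchSlotDeltaDischarge23 + HodgeCM.Model.ThetaSideInstance (landed); def muSlotZero + 17 theorems; NAMES: muSharp₂₃_muSlotZero_apply · muSharp₂₃_apply_eq_add · muSharp₂₃_mu₀) (`HOME/pub-hodgecm-own-mu/stage72/HodgeCM/Model/ArchMuClosedForm.lean`, md5 ee2601ba33d7, 166 lines);
landed by the second packager p2 gen 18 (p2-g18) in gate run 72 as `HodgeCM/Model/ArchMuClosedForm.lean` (verbatim).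
-/
/-
Origin: NAMED SINGLE-OWNER PROVER `prover-pub-hodgecm-own-mu-0` (unit pub-hodgecm-own-mu; HODGE PATH TRACK 1(a), coordinator ruling
2026-08-21T03:10:08Z; BINDER-OWNERS row 6 `μ` taken over by name from glue-1, HOME/INBOX.md 2026-08-21T04:02:44Z), 2026-08-21.
Target in PKG: `HodgeCM/Model/ArchMuClosedForm.lean` (NEW additive drop-alone leaf over theta-3's (K10) `Model/ArchSlotDeltaDischarge23` and
period-2's `Model/ThetaSideInstance`).  The zero slot table `muSlotZero` is glue-1-g11's READY-HELD `ArchSideTerm.muZero`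
(`drafts-not-staged/run57/HodgeCM/Model/ArchMuZero.lean`, STATUS l.13783 (O2)) under a distinct name; the gauge and fixed-point lemmas are new.
KERNEL ONLY: 1 `def` (an integer table) + theorems; 0 records, nothing cited, 0 `def … : Prop`, no Literature path, MODEL-N ±0,
E `Model/E2InstanceOGR21AEPIAR.lean` untouched.  Nothing here is a claim of the manuscripts under adjudication.
-/
import Summits.HodgeConjecture.HodgeCM.Model.ArchSlotDeltaDischarge23
import Summits.HodgeConjecture.HodgeCM.Model.ThetaSideInstance

/-!
# Row 6 `μ` — the closed form `μ₀ := μ♯♯(0)` of E's archimedean slot table, and why its slot-0 entry is a gauge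

E's data binder (E of record «AR» = `HodgeCM.Model.perL_picardCM_r21AEOGIAR`, `Model/E2InstanceOGR21AEPIAR.lean`:43)

  `μ : ∀ {L : CMField}, SeesawCtx L → Fin 4 → NumberField.InfinitePlace L → ℤ`

is the table of archimedean exponents of the (W-wt) weights of the four seesaw lines: `μ c k` is the type of the character by which
`U(W_k)(L⁺ ⊗ ℝ)` acts on the slot-`k` test vector (`Model/ArchTypeReadOff`, N1), and it enters E ONLY through the torus side data
`d12Of μ c = (−μ c 0, −μ c 1)`, `d34Of μ c = (−μ c 2, −μ c 3)` (`Model/ThetaSideInstance`), i.e. through the character index sets of the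
binders `gen12 ∕ real34 ∕ hyp12 ∕ hyp34`.

What the package already proves about the honest `S` of row 5 (sinst-1 `SInstance.SR…`, theta-3 (TT)/(TD)/(K10)):
* the DIFFERENCES of the slot types are closed, `V`-free, `ι₁`-free sign tables of the seesaw datum:
  `slotTypeVec 1 − slotTypeVec 0 = slotDelta c.D` (`ArchSlotBoxTorusType.slotTypeVec_one_sub_zero_eq_slotDelta`), and for the cross-plane
  slots `slotDelta₂ ∕ slotDelta₃` (`ArchSlotDeltaDischarge23`, via #1218 under (STRIP)+(VT), `hSV_holds`);
* the slot-0 ENTRY is free: the S pin twists the [GR91, 3.1.1] splitting of record by `η = (χ_V ∘ det_V)·(χ_W ∘ det_W)` with `χ_W := χOfType nW`,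
  `nW := μ c 0 − slotTypeVec 0` (`ThetaAdelicSideReadOff.archType_χOfType_nW`), so that the slot-0 weight IS `μ c 0` whatever `μ c 0` is, and the
  other three weights are `μ c 0 + slotDelta∗ c.D` — packaged as `μ♯♯ := ArchSideTerm.muSharp₂₃ μ`.

Consequently a `V`-free closed form of row 6 is fixed by its slot-0 entry alone, and that entry is a GAUGE (normalisation of the `U(W)`-side
twist `χ_W`, the package's analogue of the free choice of `χ_V`'s infinity type in PerL v5 §3.2 l. 259–262 ∕ §4.1 l. 476).  This leaf names the
representative with slot-0 entry `0`:

* `muSlotZero := 0` and **`μ₀ := muSharp₂₃ muSlotZero`** with `μ₀ c = (0, slotDelta c.D, slotDelta₂ c.D, slotDelta₃ c.D)`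
  (`muSharp₂₃_muSlotZero_zero ∕ _one ∕ _two ∕ _three`, `muSharp₂₃_muSlotZero_apply`);
* GAUGE: `muSharp₂₃ μ c k = μ c 0 + muSharp₂₃ muSlotZero c k` for EVERY `μ` (`muSharp₂₃_apply_eq_add`) — every (J-μ)-sharpened table is
  `μ₀` shifted by its slot-0 entry;
* FIXED POINT: `muSharp₂₃ (muSharp₂₃ μ) = muSharp₂₃ μ` (`muSharp₂₃_idem`), in particular `μ₀` is its own sharpening (`muSharp₂₃_mu₀`), so an
  E-shaped term fed `μ := μ₀` and then sharpened reads the SAME table;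
* the side data of record at `μ₀`: `d12Of μ₀ c = (0, −slotDelta c.D)`, `d34Of μ₀ c = (−slotDelta₂ c.D, −slotDelta₃ c.D)` (`d12Of_mu₀_m₁` …).

NOT honest, for contrast (recorded as arithmetic, `muSlotZero_ne_muSharp₂₃_of_slotDelta_ne`): the RAW zero table `μ := 0` (all four entries `0`)
differs from `μ₀` at every context with `slotDelta c.D ≠ 0`, i.e. wherever lines `0` and `1` have opposite signs at some place — the raw zero
table would ask the (12) characters of `gen12` to have equal types on both factors, against `slotTypeVec_one_sub_zero_eq_slotDelta`.

Nothing here is a claim of PerL/QW8; nothing is cited.  The E corollary `μ := μ₀` (one application of «AR») is the separate leaf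
`Model/E2InstanceOGR21AEPIARM.lean`.
-/

set_option autoImplicit false

noncomputable section

namespace HodgeCM.Model.ArchSideTerm

open HodgeCM.Model (d12Of d34Of d12Of_m₁ d12Of_m₂ d34Of_m₁ d34Of_m₂)

/-- **the zero slot table** (glue-1-g11's `muZero`, renamed): `μ c k w = 0` for all `c k w`. -/
def muSlotZero : ∀ {L : CMField}, SeesawCtx L → Fin 4 → NumberField.InfinitePlace (L : Type) → ℤ :=
  fun _ _ _ => 0

variable {L : CMField} (c : SeesawCtx L)

/-- (Ported verbatim from the HodgeCMPerL package; no docstring in the source.) -/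
@[simp] theorem muSlotZero_apply (k : Fin 4) (w : NumberField.InfinitePlace (L : Type)) : muSlotZero c k w = 0 := rfl

/-- (Ported verbatim from the HodgeCMPerL package; no docstring in the source.) -/
theorem muSlotZero_eq_zero (k : Fin 4) : muSlotZero c k = 0 := rfl

/-! ## §1 the closed form `μ₀ := μ♯♯(0)` entry by entry -/

/-- slot 0 of `μ₀` is `0`. -/
theorem muSharp₂₃_muSlotZero_zero : muSharp₂₃ @muSlotZero c 0 = 0 := by
  rw [muSharp₂₃_zero]; rfl

/-- slot 1 of `μ₀` is the (12) sign table `slotDelta c.D`. -/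
theorem muSharp₂₃_muSlotZero_one : muSharp₂₃ @muSlotZero c 1 = slotDelta c.D := by
  rw [muSharp₂₃_one]; exact zero_add _

/-- slot 2 of `μ₀` is the cross-plane table `slotDelta₂ c.D`. -/
theorem muSharp₂₃_muSlotZero_two : muSharp₂₃ @muSlotZero c 2 = slotDelta₂ c.D := by
  rw [muSharp₂₃_two]; exact zero_add _

/-- slot 3 of `μ₀` is the cross-plane table `slotDelta₃ c.D`. -/
theorem muSharp₂₃_muSlotZero_three : muSharp₂₃ @muSlotZero c 3 = slotDelta₃ c.D := by
  rw [muSharp₂₃_three]; exact zero_add _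

/-- **`μ₀` as ONE table**: `μ₀ c = (0, slotDelta c.D, slotDelta₂ c.D, slotDelta₃ c.D)`. -/
theorem muSharp₂₃_muSlotZero_apply (k : Fin 4) :
    muSharp₂₃ @muSlotZero c k = ![0, slotDelta c.D, slotDelta₂ c.D, slotDelta₃ c.D] k := by
  fin_cases k
  · exact muSharp₂₃_muSlotZero_zero c
  · exact muSharp₂₃_muSlotZero_one c
  · exact muSharp₂₃_muSlotZero_two c
  · exact muSharp₂₃_muSlotZero_three c

/-! ## §2 GAUGE: every sharpened table is `μ₀` shifted by its slot-0 entry -/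

/-- **GAUGE LEMMA**: for every slot table `μ`, `μ♯♯ c k = μ c 0 + μ₀ c k`.  The (J-μ) sharpening of ANY datum is the closed form
translated by the slot-0 entry; the slot-0 entry is the only freedom, and it is absorbed by the S pin's `χ_W`-twist
(`SInstance.archType_χOfType_nW`: the chosen `χ_W` has type `μ c 0 − slotTypeVec 0`). -/
theorem muSharp₂₃_apply_eq_add (μ : ∀ {L : CMField}, SeesawCtx L → Fin 4 → NumberField.InfinitePlace L → ℤ) (k : Fin 4) :
    muSharp₂₃ μ c k = μ c 0 + muSharp₂₃ @muSlotZero c k := by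
  fin_cases k
  · show muSharp₂₃ μ c 0 = μ c 0 + muSharp₂₃ @muSlotZero c 0
    rw [muSharp₂₃_zero, muSharp₂₃_muSlotZero_zero, add_zero]
  · show muSharp₂₃ μ c 1 = μ c 0 + muSharp₂₃ @muSlotZero c 1
    rw [muSharp₂₃_one, muSharp₂₃_muSlotZero_one]
  · show muSharp₂₃ μ c 2 = μ c 0 + muSharp₂₃ @muSlotZero c 2
    rw [muSharp₂₃_two, muSharp₂₃_muSlotZero_two]
  · show muSharp₂₃ μ c 3 = μ c 0 + muSharp₂₃ @muSlotZero c 3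
    rw [muSharp₂₃_three, muSharp₂₃_muSlotZero_three]

/-- the gauge lemma as an identity of tables. -/
theorem muSharp₂₃_eq_add (μ : ∀ {L : CMField}, SeesawCtx L → Fin 4 → NumberField.InfinitePlace L → ℤ) :
    muSharp₂₃ μ c = fun k => μ c 0 + muSharp₂₃ @muSlotZero c k :=
  funext (muSharp₂₃_apply_eq_add c μ)

/-- two data with the same slot-0 entry have the same sharpening (the entries `1, 2, 3` of the datum are never read). -/
theorem muSharp₂₃_congr_slotZero (μ ν : ∀ {L : CMField}, SeesawCtx L → Fin 4 → NumberField.InfinitePlace L → ℤ)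
    (h : μ c 0 = ν c 0) : muSharp₂₃ μ c = muSharp₂₃ ν c := by
  rw [muSharp₂₃_eq_add c μ, muSharp₂₃_eq_add c ν, h]

/-! ## §3 FIXED POINT: sharpening is idempotent -/

/-- **`μ♯♯` is idempotent**: sharpening a sharpened table changes nothing (its slot-0 entry is preserved). -/
theorem muSharp₂₃_idem (μ : ∀ {L : CMField}, SeesawCtx L → Fin 4 → NumberField.InfinitePlace L → ℤ) :
    muSharp₂₃ (fun {L : CMField} (c : SeesawCtx L) => muSharp₂₃ μ c) c = muSharp₂₃ μ c :=
  muSharp₂₃_congr_slotZero c _ _ (muSharp₂₃_zero μ c)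

/-- in particular **`μ₀` is its own sharpening**: an E-shaped term fed `μ := μ₀` and sharpened internally reads the table `μ₀` itself. -/
theorem muSharp₂₃_mu₀ :
    muSharp₂₃ (fun {L : CMField} (c : SeesawCtx L) => muSharp₂₃ @muSlotZero c) c = muSharp₂₃ @muSlotZero c :=
  muSharp₂₃_idem c @muSlotZero

/-! ## §4 the torus side data of record at `μ₀` -/

/-- (12) side, first factor: type `0`. -/
theorem d12Of_mu₀_m₁ : (d12Of (fun {L : CMField} (c : SeesawCtx L) => muSharp₂₃ @muSlotZero c) c).m₁ = 0 := by
  rw [d12Of_m₁, muSharp₂₃_muSlotZero_zero, neg_zero]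

/-- (12) side, second factor: type `−slotDelta c.D`. -/
theorem d12Of_mu₀_m₂ : (d12Of (fun {L : CMField} (c : SeesawCtx L) => muSharp₂₃ @muSlotZero c) c).m₂ = -slotDelta c.D := by
  rw [d12Of_m₂, muSharp₂₃_muSlotZero_one]

/-- (34) side, first factor: type `−slotDelta₂ c.D`. -/
theorem d34Of_mu₀_m₁ : (d34Of (fun {L : CMField} (c : SeesawCtx L) => muSharp₂₃ @muSlotZero c) c).m₁ = -slotDelta₂ c.D := by
  rw [d34Of_m₁, muSharp₂₃_muSlotZero_two]

/-- (34) side, second factor: type `−slotDelta₃ c.D`. -/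
theorem d34Of_mu₀_m₂ : (d34Of (fun {L : CMField} (c : SeesawCtx L) => muSharp₂₃ @muSlotZero c) c).m₂ = -slotDelta₃ c.D := by
  rw [d34Of_m₂, muSharp₂₃_muSlotZero_three]

/-! ## §5 contrast: the RAW zero table is not the closed form -/

/-- wherever the (12) sign table is non-zero — lines `0` and `1` of opposite sign at some place — the raw zero table differs from `μ₀`
at slot `1`: feeding E `μ := 0` WITHOUT the sharpening would prescribe equal (12) character types on both factors. -/
theorem muSlotZero_ne_muSharp₂₃_of_slotDelta_ne {w : NumberField.InfinitePlace (L : Type)} (h : slotDelta c.D w ≠ 0) :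
    muSlotZero c 1 w ≠ muSharp₂₃ @muSlotZero c 1 w := by
  rw [muSharp₂₃_muSlotZero_one, muSlotZero_apply]
  exact fun h0 => h h0.symm

end HodgeCM.Model.ArchSideTerm

end
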